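import Summits.HodgeConjecture.CorCM.MumfordTateRankSevenSplit
import HarnessLib

/-!
# A complex abelian variety with SIMPLE Hodge Lie algebra: along every idempotent `e ∈ End⁰(X)` both parts of the
# splitting `X ∼ im e ⊞ (complement)` carry a faithful restriction of `Lie Hg(H¹X)` — `dim Lie Hg` and `dim MT` do not drop

COR-CM (cell `pub-hodgecm2`, seat `b27` gen 39, count-neutral lane MT-RANK-SEVEN-SPLIT; theorems only, no definition,
no named fact; UNCONDITIONAL — nothing here uses or asserts HC_CM).  First step into the `ℚ`-SIMPLE branch of the dichotomy
`CorCM/MumfordTateRankSevenSemisimple` (there: `Lie Hg(H¹X)` simple of dimension `6`, or `X ∼ B₁^{a+1} × B₂^{b+1}`); the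
statements below hold for a simple Hodge Lie algebra of ANY dimension.

* §1 `finrank_hodgeLie_le_of_quasiRetraction_of_isSimple` — GENERIC: along a quasi-retraction `t : X → Z`, `j : Z → X` with
  `j^* t^* = M ≠ 0`, `t^* j^* = M − M p` for a Hodge endomorphism `p ≠ 1` of `H¹(X)` (no block hypothesis on `Lie Hg`), the
  restriction `r : W ↦ M⁻¹ j^* W t^*` maps `Lie Hg(H¹X)` into `Lie Hg(H¹Z)` (`HodgeStructure.comp_mem_hodgeLie_of_retract`,
  gen 35) and is MULTIPLICATIVE on `Lie Hg(H¹X)` (its elements commute with `p`, and `j^* p = 0`); its kernel is therefore an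
  ideal, which for a SIMPLE `Lie Hg(H¹X)` is `0` — it is not everything because the Hodge operator `2P − 1` does not kill the
  block `(1 − p)H¹ ≠ 0`.  Hence **`dim Lie Hg(H¹X) ≤ dim Lie Hg(H¹Z)`**.
* §2 **`exists_splitting_le_of_idempotent_of_isSimple`** — for `X` with `0 < dim X`, SIMPLE `Lie Hg(H¹X)` and ANY
  idempotent `e ∈ End⁰(X)`, `e ∉ {0, 1}` (centrality is not needed: `Lie Hg` commutes with all of `End_Hdg`): the Poincaré
  splitting `X ∼ Y ⊞ Z` along `e` (`i h = M e`, `h i = M`, `t j = M`, `i ≫ t = 0`, `j ≫ h = 0`) has `0 < dim Y`, `0 < dim Z`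
  and **`dim Lie Hg(H¹X) ≤ dim Lie Hg(H¹Y)`, `dim Lie Hg(H¹X) ≤ dim Lie Hg(H¹Z)`, `dim MT(H¹X) ≤ dim MT(H¹Y)`,
  `dim MT(H¹X) ≤ dim MT(H¹Z)`** — the Lie form of «`hg(X) ⊆ hg(Y) ⊕ hg(Z)` projects injectively to both» (Moonen–Zarhin 1999
  §3 (3.1): `𝔤₁ = 𝔤₂ = 0`).  So an abelian variety with `ℚ`-simple Hodge Lie algebra of dimension `6` (`dim MT = 7`) has no
  abelian subvariety or quotient of Mumford–Tate rank `< 7`: no elliptic curve (`dim MT ≤ 4`), no CM subvariety of dimension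
  `< 6` (`dim MT(H¹A) ≤ dim A + 1` for `A` of CM type), ….

## References

* [MoonenZarhin1999LowDim] B. Moonen, Yu. Zarhin, *Hodge classes on abelian varieties of low dimension*, Math. Ann.
  315 (1999), §2 and §3 (3.1).
* [Deligne1982HodgeCycles] P. Deligne, *Hodge cycles on abelian varieties*, LNM 900 (1982), I §3 Prop. 3.4.
* [MumfordAV1970] D. Mumford, *Abelian Varieties* (1970), §19 Thm. 1 and proof of Cor. 2 (pp. 173–174).
* [Humphreys1972] J. E. Humphreys, *Introduction to Lie Algebras and Representation Theory*, GTM 9 (1972), §5.2.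
-/

noncomputable section

open scoped TensorProduct
open CategoryTheory CategoryTheory.Limits Module

namespace Summit.HodgeConjecture.CorCM

open Literature.AlgebraicGeometry.Motives
open Literature.AlgebraicGeometry.Motives.AbelianVariety
open Literature.AlgebraicGeometry.Motives.HodgeStructure
open Literature.AlgebraicGeometry.HodgeTheory
open Literature.AlgebraicGeometry.ComplexMultiplication (bettiRep bettiRep_injective bettiRep_of
  bettiCohomology_map_add_one bettiCohomology_map_comp_hom bettiCohomology_map_nsmul_id_one bettiCohomology_map_zero_one)
open Literature.AlgebraicGeometry.Milne1999 (IsOfCMType)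

variable [HodgeTensorFacts.{0, 0}]

/-! ## §1 The restriction along a quasi-retraction is injective on a simple Hodge Lie algebra -/

/-- **`dim Lie Hg(H¹X) ≤ dim Lie Hg(H¹Z)` along a quasi-retraction, for a SIMPLE `Lie Hg(H¹X)`.**  Let `t : X → Z`,
`j : Z → X` with `j^* t^* = M ≠ 0`, `t^* j^* = M − M p` on `H¹(X)` for an idempotent Hodge endomorphism `p ≠ 1`, and let some Lie
subalgebra of `𝔤𝔩(H¹X)` with carrier `Lie Hg(H¹X)` be a simple Lie algebra.  Then `W ↦ M⁻¹ j^* W t^*` is an INJECTIVE map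
`Lie Hg(H¹X) → Lie Hg(H¹Z)` (it lands in `Lie Hg(H¹Z)` by `comp_mem_hodgeLie_of_retract`; it is multiplicative because `Lie Hg`
commutes with `p` and `j^* p = 0`; its kernel is an ideal, not everything since `2P − 1` does not kill `(1 − p)H¹ ≠ 0`, hence
`0`). [cite: MoonenZarhin1999LowDim, §2 and §3 (3.1)] [cite: Deligne1982HodgeCycles, I §3 Prop. 3.4] [cite: Humphreys1972, §5.2] -/
theorem finrank_hodgeLie_le_of_quasiRetraction_of_isSimple {X Z : AbelianVariety ℂ} (hX : IsSmoothProjective X.dim X.X)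
    (hZ : IsSmoothProjective Z.dim Z.X) (t : X ⟶ Z) (j : Z ⟶ X) {M : ℕ} (hM : M ≠ 0)
    {p : Module.End ℚ (bettiCohomology X.X 1)}
    (hjt : (bettiCohomology.map j.hom.hom.hom 1).hom ∘ₗ (bettiCohomology.map t.hom.hom.hom 1).hom =
      (M : ℚ) • LinearMap.id)
    (htj : (bettiCohomology.map t.hom.hom.hom 1).hom ∘ₗ (bettiCohomology.map j.hom.hom.hom 1).hom =
      (M : ℚ) • LinearMap.id - (M : ℚ) • p)
    (hpA : haveI := BettiUniverse.finite hX 1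
      p ∈ (BettiUniverse.hodge exists_isReal_hodgeModel_holds hX 1).endAlg) (hpp : p * p = p) (hp1 : p ≠ 1)
    (hsimple : haveI := BettiUniverse.finite hX 1
      letI : LieRing (Module.End ℚ (bettiCohomology X.X 1)) := LieRing.ofAssociativeRing
      ∃ 𝔏 : LieSubalgebra ℚ (Module.End ℚ (bettiCohomology X.X 1)),
        𝔏.toSubmodule = (BettiUniverse.hodge exists_isReal_hodgeModel_holds hX 1).hodgeLie ∧ LieAlgebra.IsSimple ℚ 𝔏) :
    haveI := BettiUniverse.finite hX 1
    haveI := BettiUniverse.finite hZ 1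
    Module.finrank ℚ (BettiUniverse.hodge exists_isReal_hodgeModel_holds hX 1).hodgeLie ≤
      Module.finrank ℚ (BettiUniverse.hodge exists_isReal_hodgeModel_holds hZ 1).hodgeLie := by
  classical
  haveI := BettiUniverse.finite hX 1
  haveI := BettiUniverse.finite hZ 1
  letI : LieRing (Module.End ℚ (bettiCohomology X.X 1)) := LieRing.ofAssociativeRing
  have hM' : (M : ℚ) ≠ 0 := Nat.cast_ne_zero.2 hM
  set H := BettiUniverse.hodge exists_isReal_hodgeModel_holds hX 1 with hH
  set HZ := BettiUniverse.hodge exists_isReal_hodgeModel_holds hZ 1 with hHZ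
  set jH := (bettiCohomology.map j.hom.hom.hom 1).hom with hjH
  set tH := (bettiCohomology.map t.hom.hom.hom 1).hom with htH
  -- the restriction map `r W = M⁻¹ j^* W t^*` lands in `Lie Hg(H¹Z)`
  let r : Module.End ℚ (bettiCohomology X.X 1) →ₗ[ℚ] Module.End ℚ (bettiCohomology Z.X 1) :=
    (M : ℚ)⁻¹ • ((LinearMap.llcomp ℚ _ _ _ jH) ∘ₗ (LinearMap.lcomp ℚ _ tH))
  have hr : ∀ W, r W = (M : ℚ)⁻¹ • (jH ∘ₗ W ∘ₗ tH) := fun W => rfl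
  have hπF : ∀ q, (H.F q).map (((M : ℚ)⁻¹ • jH).baseChange ℂ) ≤ HZ.F q := by
    intro q
    rintro _ ⟨x, hx, rfl⟩
    rw [LinearMap.baseChange_smul, LinearMap.smul_apply]
    exact Submodule.smul_of_tower_mem _ (M : ℚ)⁻¹ (map_F_le_hodge_one hZ hX j q ⟨x, hx, rfl⟩)
  let ιH : Hom HZ H := ⟨tH, fun q => map_F_le_hodge_one hX hZ t q⟩
  let πH : Hom H HZ := ⟨(M : ℚ)⁻¹ • jH, hπF⟩
  have hπι : ∀ v, πH.toLinearMap (ιH.toLinearMap v) = v := by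
    intro v
    change ((M : ℚ)⁻¹ • jH) (tH v) = v
    rw [LinearMap.smul_apply, ← LinearMap.comp_apply, hjt, LinearMap.smul_apply, LinearMap.id_apply, smul_smul,
      inv_mul_cancel₀ hM', one_smul]
  have hrmem : ∀ W ∈ H.hodgeLie, r W ∈ HZ.hodgeLie := by
    intro W hW
    have h := comp_mem_hodgeLie_of_retract ιH πH hπι hW
    have h' : πH.toLinearMap ∘ₗ W ∘ₗ ιH.toLinearMap = r W := by
      rw [hr]
      change ((M : ℚ)⁻¹ • jH) ∘ₗ W ∘ₗ tH = _
      rw [LinearMap.smul_comp]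
    rwa [h'] at h
  -- `j^* p = 0`; `r` is multiplicative on `Lie Hg(H¹X)`
  have hjp : jH ∘ₗ p = 0 := by
    have h1 : jH ∘ₗ (tH ∘ₗ jH) = (jH ∘ₗ tH) ∘ₗ jH := (LinearMap.comp_assoc _ _ _).symm
    rw [htj, hjt, LinearMap.comp_sub, LinearMap.comp_smul, LinearMap.comp_smul, LinearMap.comp_id,
      LinearMap.smul_comp, LinearMap.id_comp, sub_eq_self] at h1
    exact (smul_eq_zero.1 h1).resolve_left hM'
  have hWp : ∀ W ∈ H.hodgeLie, W * p = p * W := fun W hW => H.commute_of_mem_hodgeLie hW ⟨p, hpA⟩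
  have hrmul : ∀ W ∈ H.hodgeLie, ∀ W', r W * r W' = r (W * W') := by
    intro W hW W'
    have h1 : r W * r W' = ((M : ℚ)⁻¹ * (M : ℚ)⁻¹) • (jH ∘ₗ W ∘ₗ ((tH ∘ₗ jH) ∘ₗ (W' ∘ₗ tH))) := by
      rw [hr, hr, smul_mul_smul_comm, Module.End.mul_eq_comp]
      simp only [LinearMap.comp_assoc]
    have h2 : jH ∘ₗ W ∘ₗ (p ∘ₗ (W' ∘ₗ tH)) = 0 := by
      rw [← LinearMap.comp_assoc (W' ∘ₗ tH) p W, ← Module.End.mul_eq_comp (f := W) (g := p), hWp W hW,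
        Module.End.mul_eq_comp, LinearMap.comp_assoc, ← LinearMap.comp_assoc _ p jH, hjp, LinearMap.zero_comp]
    rw [h1, htj, LinearMap.sub_comp, LinearMap.smul_comp, LinearMap.smul_comp, LinearMap.id_comp, LinearMap.comp_sub,
      LinearMap.comp_sub, LinearMap.comp_smul, LinearMap.comp_smul, LinearMap.comp_smul, LinearMap.comp_smul, h2, smul_zero,
      sub_zero, smul_smul, mul_assoc, inv_mul_cancel₀ hM', mul_one, hr, Module.End.mul_eq_comp]
    simp only [LinearMap.comp_assoc]
  -- the kernel of `r` on `Lie Hg` is an ideal of the simple Lie algebra, hence `⊥` or `⊤`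
  obtain ⟨𝔏, h𝔏, h𝔏s⟩ := hsimple
  have hmem : ∀ {x : Module.End ℚ (bettiCohomology X.X 1)}, x ∈ 𝔏 ↔ x ∈ H.hodgeLie := by
    intro x
    rw [← LieSubalgebra.mem_toSubmodule, h𝔏]
  let K : LieIdeal ℚ 𝔏 :=
    { carrier := {x | r (x : Module.End ℚ (bettiCohomology X.X 1)) = 0}
      add_mem' := fun {a b} ha hb => by
        simp only [Set.mem_setOf_eq] at ha hb ⊢
        change r ((a : Module.End ℚ (bettiCohomology X.X 1)) + b) = 0
        rw [map_add, ha, hb, add_zero]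
      zero_mem' := by simp only [Set.mem_setOf_eq, ZeroMemClass.coe_zero, map_zero]
      smul_mem' := fun c {x} hx => by
        simp only [Set.mem_setOf_eq] at hx ⊢
        change r (c • (x : Module.End ℚ (bettiCohomology X.X 1))) = 0
        rw [map_smul, hx, smul_zero]
      lie_mem := fun {w x} hx => by
        simp only [Set.mem_setOf_eq] at hx ⊢
        rw [LieSubalgebra.coe_bracket, LieRing.of_associative_ring_bracket, map_sub, ← hrmul _ (hmem.1 w.2),
          ← hrmul _ (hmem.1 x.2), hx, mul_zero, zero_mul, sub_self] }
  have hK : ∀ x : 𝔏, x ∈ K ↔ r (x : Module.End ℚ (bettiCohomology X.X 1)) = 0 := fun x => Iff.rfl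
  rcases h𝔏s.eq_bot_or_eq_top K with hbot | htop
  · -- `r` is injective on `Lie Hg(H¹X)`
    have hinj : ∀ W ∈ H.hodgeLie, r W = 0 → W = 0 := by
      intro W hW hrW
      have hx : (⟨W, hmem.2 hW⟩ : 𝔏) ∈ K := (hK _).2 hrW
      rw [hbot] at hx
      exact congrArg Subtype.val ((LieSubmodule.mem_bot _).1 hx)
    have hle : H.hodgeLie.map r ≤ HZ.hodgeLie := by
      rintro _ ⟨W, hW, rfl⟩
      exact hrmem W hW
    calc Module.finrank ℚ H.hodgeLie = Module.finrank ℚ (H.hodgeLie.map r) := by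
          rw [← LinearMap.range_domRestrict]
          refine (LinearMap.finrank_range_of_inj fun a b hab => ?_).symm
          apply Subtype.ext
          have h := hinj (a.1 - b.1) (Submodule.sub_mem _ a.2 b.2) (by
            rw [map_sub]
            exact sub_eq_zero.2 hab)
          exact sub_eq_zero.1 h
      _ ≤ Module.finrank ℚ HZ.hodgeLie := Submodule.finrank_mono hle
  · -- `r = 0` on `Lie Hg(H¹X)`: then `Lie Hg` kills the block `(1 − p)H¹`, so does `2P − 1`, and `p = 1`
    exfalso
    have hzero : ∀ W ∈ H.hodgeLie, W * (1 - p) = 0 := by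
      intro W hW
      have hx : (⟨W, hmem.2 hW⟩ : 𝔏) ∈ K := by rw [htop]; exact LieSubmodule.mem_top _
      have h0 : jH ∘ₗ W ∘ₗ tH = 0 := by
        have h := (hK _).1 hx
        rw [hr] at h
        exact (smul_eq_zero.1 h).resolve_left (inv_ne_zero hM')
      -- `t^* (j^* W t^*) j^* = (M − Mp) W (M − Mp) = M² W (1 − p)`
      have h1 : tH ∘ₗ (jH ∘ₗ W ∘ₗ tH) ∘ₗ jH = (tH ∘ₗ jH) * W * (tH ∘ₗ jH) := by
        rw [Module.End.mul_eq_comp, Module.End.mul_eq_comp]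
        simp only [LinearMap.comp_assoc]
      rw [h0, LinearMap.zero_comp, LinearMap.comp_zero, htj] at h1
      have h2 : ((M : ℚ) • LinearMap.id - (M : ℚ) • p) * W * ((M : ℚ) • LinearMap.id - (M : ℚ) • p) =
          ((M : ℚ) * M) • (W * (1 - p)) := by
        have hq : (1 - p) * (1 - p) = 1 - p := by rw [mul_sub, mul_one, sub_mul, one_mul, hpp, sub_self, sub_zero]
        have hc : (1 - p) * W = W * (1 - p) := by rw [sub_mul, mul_sub, one_mul, mul_one, hWp W hW]
        rw [← Module.End.one_eq_id, ← smul_sub, smul_mul_assoc, smul_mul_assoc, mul_smul_comm, smul_smul, hc, mul_assoc, hq]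
      rw [h2] at h1
      exact (smul_eq_zero.1 h1.symm).resolve_left (mul_ne_zero hM' hM')
    -- pass to `𝔥_ℂ` and the Hodge operator
    obtain ⟨S, deg, e, hF, hFc⟩ := exists_basis_F_eq_span H
    haveI : Fintype S := FiniteDimensional.fintypeBasisIndex e
    have heff := BettiUniverse.hodge_isEffective exists_isReal_hodgeModel_holds hX 1
    have hdeg : ∀ σ, deg σ = 0 ∨ deg σ = 1 := fun σ => by
      have h := heff.deg_mem_Icc_of_graded e hF hFc σ
      simp only [Nat.cast_one] at h
      omega
    have hPP : gradingEnd e deg * gradingEnd e deg = gradingEnd e deg := gradingEnd_mul_gradingEnd_of_deg e hdeg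
    have hΘ' : (2 : ℂ) • gradingEnd e deg - 1 ∈ H.hodgeLieC := by
      simpa only [Nat.cast_one, Int.cast_one, one_smul] using two_smul_gradingEnd_sub_mem_hodgeLieC H e hF hFc
    have hzeroC : ∀ Y ∈ H.hodgeLieC, Y * (1 - p).baseChange ℂ = 0 := by
      intro Y hY
      rw [hodgeLieC_eq_spanC] at hY
      unfold spanC at hY
      induction hY using Submodule.span_induction with
      | mem Y₀ hY₀ =>
        obtain ⟨W, hW, rfl⟩ := hY₀
        rw [← LinearMap.baseChange_mul, hzero W hW, LinearMap.baseChange_zero]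
      | zero => rw [zero_mul]
      | add x y _ _ hx hy => rw [add_mul, hx, hy, add_zero]
      | smul c x _ hx => rw [smul_mul_assoc, hx, smul_zero]
    have h1 := hzeroC _ hΘ'
    have h2 : (1 - p).baseChange ℂ = 0 := by
      have h := congrArg (fun T => ((2 : ℂ) • gradingEnd e deg - 1) * T) h1
      simp only [← mul_assoc, ProjectorBlocks.theta_mul_theta hPP, one_mul, mul_zero] at h
      exact h
    exact hp1 (sub_eq_zero.1 (eq_zero_of_baseChange_eq_zero h2)).symm

/-! ## §2 Splitting along a central idempotent: both parts keep the full Hodge Lie algebra -/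

variable {X : AbelianVariety ℂ} {n : ℕ}

/-- **A complex abelian variety with SIMPLE Hodge Lie algebra: along EVERY idempotent `e ∉ {0, 1}` of `End⁰(X)` (central or
not), both parts of the Poincaré splitting `X ∼ Y ⊞ Z` (`Y = im e`, `Z` a complement) have `dim Lie Hg ≥ dim Lie Hg(H¹X)` and
`dim MT ≥ dim MT(H¹X)`** (the restrictions of `Lie Hg(H¹X)` to `H¹(Y)` and `H¹(Z)` are injective: §1 along `(t, j, e^*)` and
`(h, i, 1 − e^*)`; `Lie Hg` commutes with every Hodge endomorphism, so no centrality is needed).  Splitting data: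
`h ≫ i = F`, `F^* = M e^*`, `i ≫ h = M`, `j ≫ t = M`, `i ≫ t = 0`, `j ≫ h = 0`, `h ≫ i + t ≫ j = M`, `(i, j) : Y ⊞ Z → X` an
isogeny, `dim Y + dim Z = dim X`, `0 < dim Y`, `0 < dim Z`.  In particular every non-trivial abelian subvariety / quotient
of such an `X` has Mumford–Tate rank `≥ dim MT(H¹X)` (Moonen–Zarhin 1999 §3 (3.1): `hg(X)` embeds in each `hg(Xᵢ)`).
[cite: MoonenZarhin1999LowDim, §2 and §3 (3.1)] [cite: MumfordAV1970, §19 Thm. 1 and proof of Cor. 2 (pp. 173–174)]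
[cite: Humphreys1972, §5.2] -/
theorem exists_splitting_le_of_idempotent_of_isSimple (hX : IsSmoothProjective n X.X) (h0 : 0 < X.dim)
    {e : X.endAlgebra} (hee : e * e = e) (he0 : e ≠ 0) (he1 : e ≠ 1)
    (hsimple : haveI := BettiUniverse.finite hX 1
      letI : LieRing (Module.End ℚ (bettiCohomology X.X 1)) := LieRing.ofAssociativeRing
      ∃ 𝔏 : LieSubalgebra ℚ (Module.End ℚ (bettiCohomology X.X 1)),
        𝔏.toSubmodule = (BettiUniverse.hodge exists_isReal_hodgeModel_holds hX 1).hodgeLie ∧ LieAlgebra.IsSimple ℚ 𝔏) :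
    haveI := BettiUniverse.finite hX 1
    ∃ (M : ℕ) (F : X ⟶ X) (Y Z : AbelianVariety ℂ) (h : X ⟶ Y) (i : Y ⟶ X) (t : X ⟶ Z) (j : Z ⟶ X),
      M ≠ 0 ∧ AbelianVariety.endAlgebra.of X F = algebraMap ℚ X.endAlgebra (M : ℚ) * e ∧
      (bettiCohomology.map F.hom.hom.hom 1).hom = (M : ℚ) • MulOpposite.unop (bettiRep X e) ∧
      h ≫ i = F ∧ i ≫ h = M • 𝟙 Y ∧ j ≫ t = M • 𝟙 Z ∧ i ≫ t = 0 ∧ j ≫ h = 0 ∧ h ≫ i + t ≫ j = M • 𝟙 X ∧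
      IsIsogeny (biprod.desc i j) ∧ Y.dim + Z.dim = X.dim ∧ 0 < Y.dim ∧ 0 < Z.dim ∧
      (haveI := BettiUniverse.finite (AbelianVariety.isSmoothProjective_holds (A := Y)) 1
       Module.finrank ℚ (BettiUniverse.hodge exists_isReal_hodgeModel_holds hX 1).hodgeLie ≤
         Module.finrank ℚ (BettiUniverse.hodge exists_isReal_hodgeModel_holds
           (AbelianVariety.isSmoothProjective_holds (A := Y)) 1).hodgeLie) ∧
      (haveI := BettiUniverse.finite (AbelianVariety.isSmoothProjective_holds (A := Z)) 1
       Module.finrank ℚ (BettiUniverse.hodge exists_isReal_hodgeModel_holds hX 1).hodgeLie ≤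
         Module.finrank ℚ (BettiUniverse.hodge exists_isReal_hodgeModel_holds
           (AbelianVariety.isSmoothProjective_holds (A := Z)) 1).hodgeLie) ∧
      (haveI := BettiUniverse.finite (AbelianVariety.isSmoothProjective_holds (A := Y)) 1
       (BettiUniverse.hodge exists_isReal_hodgeModel_holds hX 1).mtRank ≤
         (BettiUniverse.hodge exists_isReal_hodgeModel_holds (AbelianVariety.isSmoothProjective_holds (A := Y)) 1).mtRank) ∧
      (haveI := BettiUniverse.finite (AbelianVariety.isSmoothProjective_holds (A := Z)) 1
       (BettiUniverse.hodge exists_isReal_hodgeModel_holds hX 1).mtRank ≤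
         (BettiUniverse.hodge exists_isReal_hodgeModel_holds (AbelianVariety.isSmoothProjective_holds (A := Z)) 1).mtRank) := by
  have hn : X.dim = n := schemeDim_eq_holds hX
  subst hn
  haveI := BettiUniverse.finite hX 1
  have hZsp : ∀ A : AbelianVariety ℂ, IsSmoothProjective A.dim A.X := fun A => AbelianVariety.isSmoothProjective_holds
  set H := BettiUniverse.hodge exists_isReal_hodgeModel_holds hX 1 with hH
  set p : Module.End ℚ (bettiCohomology X.X 1) := MulOpposite.unop (bettiRep X e) with hpdef
  have hpA : p ∈ H.endAlg :=
    Literature.AlgebraicGeometry.ComplexMultiplication.unop_bettiRep_mem_endAlg exists_isReal_hodgeModel_holds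
      hodgePQ_independent_of_hodgeModel_holds e
  have hpp : p * p = p := by rw [hpdef, ← MulOpposite.unop_mul, ← map_mul, hee]
  have hp0 : p ≠ 0 := fun hp => he0 (bettiRep_injective (MulOpposite.unop_injective (by
    rw [← hpdef, hp, map_zero, MulOpposite.unop_zero])))
  have hp1 : p ≠ 1 := fun hp => he1 (bettiRep_injective (MulOpposite.unop_injective (by
    rw [← hpdef, hp, map_one, MulOpposite.unop_one])))
  -- `F = M e` and the splitting
  obtain ⟨M, F, hM, hFe, hFrep, hFF⟩ := exists_sq_eq_nsmul_of_idempotent e hee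
  have hM' : (M : ℚ) ≠ 0 := Nat.cast_ne_zero.mpr hM
  have hcomp : ∀ {A B C : AbelianVariety ℂ} (f : A ⟶ B) (g : B ⟶ C),
      (bettiCohomology.map (f ≫ g).hom.hom.hom 1).hom =
        (bettiCohomology.map f.hom.hom.hom 1).hom ∘ₗ (bettiCohomology.map g.hom.hom.hom 1).hom := by
    intro A B C f g
    rw [bettiCohomology_map_comp_hom, ModuleCat.hom_comp]
  have hnsid : ∀ (A : AbelianVariety ℂ) (N : ℕ),
      (bettiCohomology.map (N • 𝟙 A : A ⟶ A).hom.hom.hom 1).hom = (N : ℚ) • (1 : Module.End ℚ _) := by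
    intro A N
    rw [bettiCohomology_map_nsmul_id_one, ModuleCat.hom_nsmul, ModuleCat.hom_id, Nat.cast_smul_eq_nsmul,
      Module.End.one_eq_id]
  have hzero : ∀ (A B : AbelianVariety ℂ), (bettiCohomology.map (0 : A ⟶ B).hom.hom.hom 1).hom = 0 := by
    intro A B
    rw [bettiCohomology_map_zero_one, ModuleCat.hom_zero]
  set Y := AbelianVariety.image F with hY
  set i : Y ⟶ X := AbelianVariety.imageι F with hidef
  set h : X ⟶ Y := AbelianVariety.toImage F with hhdef
  have hhi : h ≫ i = F := AbelianVariety.toImage_imageι F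
  have hih : i ≫ h = M • 𝟙 Y := by
    haveI := AbelianVariety.mono_of_isClosedImmersion_toSchemeHom (AbelianVariety.imageι F)
    haveI := AbelianVariety.epi_of_surjective_toSchemeHom (AbelianVariety.toImage F)
    rw [← cancel_mono (AbelianVariety.imageι F), ← cancel_epi (AbelianVariety.toImage F)]
    change h ≫ (i ≫ h) ≫ i = h ≫ (M • 𝟙 Y) ≫ i
    calc h ≫ (i ≫ h) ≫ i = (h ≫ i) ≫ (h ≫ i) := by simp only [Category.assoc]
      _ = F ≫ F := by rw [hhi]
      _ = M • F := hFF
      _ = h ≫ (M • 𝟙 Y) ≫ i := by rw [Preadditive.nsmul_comp, Category.id_comp, Preadditive.comp_nsmul, hhi]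
  obtain ⟨Z, j, t, -, hiso, hjh, hdimYZ, hld, hdl⟩ := AbelianVariety.exists_complement_of_quasiRetraction i h hM hih
  have hsum' : h ≫ i + t ≫ j = M • 𝟙 X := by rw [← biprod.lift_desc]; exact hld
  have hit : i ≫ t = 0 := by
    have h' := congrArg (fun f => biprod.inl ≫ f ≫ biprod.snd) hdl
    simpa only [biprod.inl_desc_assoc, Category.assoc, biprod.lift_snd, Preadditive.comp_nsmul, Category.comp_id,
      Category.id_comp, Preadditive.nsmul_comp, biprod.inl_snd, smul_zero] using h'
  have hjt : j ≫ t = M • 𝟙 Z := by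
    have h' := congrArg (fun f => biprod.inr ≫ f ≫ biprod.snd) hdl
    simpa only [biprod.inr_desc_assoc, Category.assoc, biprod.lift_snd, Preadditive.comp_nsmul, Category.comp_id,
      Category.id_comp, Preadditive.nsmul_comp, biprod.inr_snd] using h'
  set iS := (bettiCohomology.map i.hom.hom.hom 1).hom with hiS
  set hS := (bettiCohomology.map h.hom.hom.hom 1).hom with hhS
  set jS := (bettiCohomology.map j.hom.hom.hom 1).hom with hjS
  set tS := (bettiCohomology.map t.hom.hom.hom 1).hom with htS
  have h1 : iS ∘ₗ hS = (M : ℚ) • LinearMap.id := by rw [hiS, hhS, ← hcomp, hih, hnsid, Module.End.one_eq_id]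
  have h2 : hS ∘ₗ iS = (M : ℚ) • p := by rw [hhS, hiS, ← hcomp, hhi, hFrep]
  have h3 : jS ∘ₗ tS = (M : ℚ) • LinearMap.id := by rw [hjS, htS, ← hcomp, hjt, hnsid, Module.End.one_eq_id]
  have h4 : tS ∘ₗ jS = (M : ℚ) • LinearMap.id - (M : ℚ) • p := by
    have h' : (bettiCohomology.map (h ≫ i + t ≫ j).hom.hom.hom 1).hom = (M : ℚ) • (1 : Module.End ℚ _) := by
      rw [hsum', hnsid]
    rw [bettiCohomology_map_add_one, ModuleCat.hom_add, hcomp, hcomp, ← hhS, ← hiS, ← htS, ← hjS, h2,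
      Module.End.one_eq_id] at h'
    rw [← h']
    abel
  have h2' : hS ∘ₗ iS = (M : ℚ) • LinearMap.id - (M : ℚ) • (1 - p) := by rw [h2, smul_sub, Module.End.one_eq_id]; abel
  have h1pA : (1 - p) ∈ H.endAlg := H.endAlg.sub_mem (Subalgebra.one_mem _) hpA
  have h1pp : (1 - p) * (1 - p) = 1 - p := by rw [mul_sub, mul_one, sub_mul, one_mul, hpp, sub_self, sub_zero]
  have h1p1 : (1 - p) ≠ 1 := fun h' => hp0 (by rw [sub_eq_self] at h'; exact h')
  haveI := BettiUniverse.finite (hZsp Z) 1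
  haveI := BettiUniverse.finite (hZsp Y) 1
  -- `0 < dim Y`, `0 < dim Z`
  have hY0 : 0 < Y.dim := by
    by_contra hY0
    have hfin : Module.finrank ℚ (bettiCohomology Y.X 1) = 0 := by rw [finrank_bettiCohomology_one]; omega
    haveI : Subsingleton (bettiCohomology Y.X 1) := Module.finrank_zero_iff.1 hfin
    have hiS0 : iS = 0 := by ext v; exact Subsingleton.elim _ _
    apply hp0
    have h := h2
    rw [hiS0, LinearMap.comp_zero] at h
    exact ((smul_eq_zero.1 h.symm).resolve_left hM')
  have hZ0 : 0 < Z.dim := by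
    by_contra hZ0
    have hfin : Module.finrank ℚ (bettiCohomology Z.X 1) = 0 := by rw [finrank_bettiCohomology_one]; omega
    haveI : Subsingleton (bettiCohomology Z.X 1) := Module.finrank_zero_iff.1 hfin
    have hjS0 : jS = 0 := by ext v; exact Subsingleton.elim _ _
    apply hp1
    have h := h4
    rw [hjS0, LinearMap.comp_zero, eq_comm, sub_eq_zero] at h
    have h' := smul_right_injective (Module.End ℚ (bettiCohomology X.X 1)) hM' h
    rw [Module.End.one_eq_id]
    exact h'.symm
  -- §1 along `(t, j, p)` and `(h, i, 1 − p)`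
  have hleZ := finrank_hodgeLie_le_of_quasiRetraction_of_isSimple hX (hZsp Z) t j hM h3 h4 hpA hpp hp1 hsimple
  have hleY := finrank_hodgeLie_le_of_quasiRetraction_of_isSimple hX (hZsp Y) h i hM h1 h2' h1pA h1pp h1p1 hsimple
  refine ⟨M, F, Y, Z, h, i, t, j, hM, hFe, hFrep, hhi, hih, hjt, hit, hjh, hsum', hiso, hdimYZ, hY0, hZ0, hleY, hleZ, ?_, ?_⟩
  · rw [mtRank_hodge_one_eq_finrank_hodgeLie_add_one hX h0, mtRank_hodge_one_eq_finrank_hodgeLie_add_one (hZsp Y) hY0]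
    omega
  · rw [mtRank_hodge_one_eq_finrank_hodgeLie_add_one hX h0, mtRank_hodge_one_eq_finrank_hodgeLie_add_one (hZsp Z) hZ0]
    omega

end Summit.HodgeConjecture.CorCM

end
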